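import Mathlib
import HarnessLib
import Literature.Analysis.FluidPDE.KNSSSwirlSupNonpos
import Summits.NavierStokesRegularity.NavierStokesRegularity.Theorems.HalfSpaceWindowDoorCirculationCarryingRigiditySourcedSwirlIdentity

/-!
# Route `HalfSpaceWindowDoor`, crux `CirculationCarryingRigidity` (stmt-NavierStokesRegularity-25311) — the SOURCED SWIRL
# LIOUVILLE TOOL, part 4a: KNSS's three slice estimates for a sourced triple

For a sourced swirl triple (`…Defs.IsSourcedSwirl`) on the plateau `f ≥ M − ε` on `{1 ≤ r ≤ 2, |z| ≤ L} × (1,T)`: the tree's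
`IsKNSSSwirlPair.estimate_I/II/III` (KNSS 2009, (5.18)–(5.20)) verbatim — the extra drift does not enter these terms:
`estimate_I` (the `∂ₛφ` term), `near_bound`/`far_bound`/`estimate_II` (transport by `u` + Laplacian of the cut-off),
`estimate_III` (the axis term `≤ −ζ (M−ε) 4c₂(L−1)`).

Seat ns-hsw-p1 g3 (LEAD of 25311, cell pub-ns-dss).  WHAT THIS IS NOT: not a statement about Navier–Stokes regularity; a linear
parabolic Liouville tool (KNSS 2009 Thm 5.3 with an extra radial drift); helper `--supports` 25311.
-/

noncomputable section

-- the summit and its single sub-problem share the name (CONVENTIONS §1), as in every Theorems file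
set_option linter.dupNamespace false

namespace Summit.NavierStokesRegularity.NavierStokesRegularity.Theorems.HalfSpaceWindowDoorCirculationCarryingRigiditySourcedSwirlEstimates

open MeasureTheory Set Function Filter Topology TopologicalSpace InnerProductSpace WithLp Metric
open scoped Laplacian RealInnerProductSpace ContDiff
open Literature.Analysis Literature.Analysis.FluidPDE
open Summit.NavierStokesRegularity.NavierStokesRegularity.Theorems.HalfSpaceWindowDoorCirculationCarryingRigidityDefs
open Summit.NavierStokesRegularity.NavierStokesRegularity.Theorems.HalfSpaceWindowDoorCirculationCarryingRigiditySourcedSwirl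
open Summit.NavierStokesRegularity.NavierStokesRegularity.Theorems.HalfSpaceWindowDoorCirculationCarryingRigiditySourcedSwirlPlateau
open Summit.NavierStokesRegularity.NavierStokesRegularity.Theorems.HalfSpaceWindowDoorCirculationCarryingRigiditySourcedSwirlSpaceTime
open Summit.NavierStokesRegularity.NavierStokesRegularity.Theorems.HalfSpaceWindowDoorCirculationCarryingRigiditySourcedSwirlIdentity
open Summit.NavierStokesRegularity.NavierStokesRegularity.Theorems.HalfSpaceWindowDoorCirculationCarryingRigiditySourcedSwirl.IsSourcedSwirl
open Summit.NavierStokesRegularity.NavierStokesRegularity.Theorems.HalfSpaceWindowDoorCirculationCarryingRigiditySourcedSwirlPlateau.IsSourcedSwirl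
open Summit.NavierStokesRegularity.NavierStokesRegularity.Theorems.HalfSpaceWindowDoorCirculationCarryingRigiditySourcedSwirlSpaceTime.IsSourcedSwirl
open Summit.NavierStokesRegularity.NavierStokesRegularity.Theorems.HalfSpaceWindowDoorCirculationCarryingRigiditySourcedSwirlIdentity.IsSourcedSwirl

namespace IsSourcedSwirl

variable {Cf Cu A τ' : ℝ} {F : ℝ → (EuclideanSpace ℝ (Fin 3)) → ℝ} {V : ℝ → (EuclideanSpace ℝ (Fin 3)) → (EuclideanSpace ℝ (Fin 3))}
  {B : ℝ → (EuclideanSpace ℝ (Fin 3)) → ℝ}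

/-! ### The three KNSS estimates (tree `IsKNSSSwirlPair.estimate_I/II/III`, verbatim for sourced triples) -/

/-- **Estimate of the time-derivative term `I`** (KNSS 2009, (5.18): `|I| ≤ C L δ² + O(ε)`, here
with `δ = 1`): on a slice `s ∈ (0, T]`,
`|∫ (F − M) ψ ζ'(s) dy| ≤ |ζ'(s)| · 2L ((C_f + M) |B̄₁| + ε |B̄₂|)` — the unit cylinder contributes
through `|F − M| ≤ C_f + M`, the rest of the support through the plateau `|F − M| ≤ ε`. -/
theorem estimate_I (hP : IsSourcedSwirl Cf Cu A τ' F V B) {L T M ε : ℝ} (hL : 0 ≤ L)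
    (hTτ : T < τ') (hε : 0 ≤ ε) (hFM : ∀ s < τ', ∀ y, F s y ≤ M)
    (hge : ∀ s ∈ Ioo 1 T, ∀ y ∈ annCylClosed 1 2 L, M - ε ≤ F s y) {s : ℝ} (hs : s ∈ Ioc 0 T) :
    |∫ y, (F s y - M) * (psiCut L y * deriv (zetaCut T) s)| ≤
      |deriv (zetaCut T) s| * (2 * L * ((Cf + M) * volume.real (closedBall (0 : EuclideanSpace ℝ (Fin 2)) 1) +
        ε * volume.real (closedBall (0 : EuclideanSpace ℝ (Fin 2)) 2))) := by
  have hsτ : s < τ' := lt_of_le_of_lt hs.2 hTτ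
  have hCf := Cf_nonneg hP
  have hM : 0 ≤ Cf + M := by
    have := hFM s hsτ 0
    have h2 := (_root_.abs_le.1 (hP.abs_le s hsτ 0)).1
    linarith
  have hz0 : 0 ≤ |deriv (zetaCut T) s| := abs_nonneg _
  set bound : (EuclideanSpace ℝ (Fin 3)) → ℝ := fun y => |deriv (zetaCut T) s| *
    ((Cf + M) * (solidCylinder 1 L).indicator (fun _ => (1 : ℝ)) y +
      ε * (solidCylinder 2 L).indicator (fun _ => (1 : ℝ)) y) with hbound
  have hi1 : Integrable ((solidCylinder 1 L).indicator fun _ : (EuclideanSpace ℝ (Fin 3)) => (1 : ℝ)) :=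
    (integrableOn_const (C := (1 : ℝ)) (volume_solidCylinder_lt_top 1 L).ne).integrable_indicator
      (measurableSet_solidCylinder 1 L)
  have hi2 : Integrable ((solidCylinder 2 L).indicator fun _ : (EuclideanSpace ℝ (Fin 3)) => (1 : ℝ)) :=
    (integrableOn_const (C := (1 : ℝ)) (volume_solidCylinder_lt_top 2 L).ne).integrable_indicator
      (measurableSet_solidCylinder 2 L)
  have hbint : Integrable bound := ((hi1.const_mul _).add (hi2.const_mul _)).const_mul _
  have hind1 : ∀ y, 0 ≤ (solidCylinder 1 L).indicator (fun _ : (EuclideanSpace ℝ (Fin 3)) => (1 : ℝ)) y := fun y =>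
    indicator_nonneg (fun _ _ => zero_le_one) _
  have hind2 : ∀ y, 0 ≤ (solidCylinder 2 L).indicator (fun _ : (EuclideanSpace ℝ (Fin 3)) => (1 : ℝ)) y := fun y =>
    indicator_nonneg (fun _ _ => zero_le_one) _
  have hle : ∀ y, ‖(F s y - M) * (psiCut L y * deriv (zetaCut T) s)‖ ≤ bound y := by
    intro y
    rw [Real.norm_eq_abs]
    have hb0 : 0 ≤ bound y := by
      simp only [hbound]
      exact mul_nonneg hz0 (add_nonneg (mul_nonneg hM (hind1 y)) (mul_nonneg hε (hind2 y)))
    by_cases hψ : psiCut L y = 0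
    · rw [hψ, zero_mul, mul_zero, abs_zero]; exact hb0
    obtain ⟨hr2, hzL⟩ := mem_of_psiCut_ne_zero hψ
    have hy2 : y ∈ solidCylinder 2 L := ⟨hr2.le, hzL.le⟩
    obtain ⟨ψ0, ψ1⟩ := psiCut_mem_Icc L y
    rw [abs_mul, abs_mul, abs_of_nonneg ψ0]
    have hψz : psiCut L y * |deriv (zetaCut T) s| ≤ |deriv (zetaCut T) s| := by
      nlinarith
    by_cases hr1 : cylRadius y ≤ 1
    · have hy1 : y ∈ solidCylinder 1 L := ⟨hr1, hzL.le⟩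
      have h1 : |F s y - M| ≤ Cf + M := abs_sub_le_of_le_of_abs_le (hFM s hsτ y) (hP.abs_le s hsτ y)
      simp only [hbound, indicator_of_mem hy1, indicator_of_mem hy2, mul_one]
      have : |F s y - M| * (psiCut L y * |deriv (zetaCut T) s|) ≤ (Cf + M) * |deriv (zetaCut T) s| :=
        mul_le_mul h1 hψz (by positivity) hM
      nlinarith
    · have hr1' : 1 < cylRadius y := lt_of_not_ge hr1
      by_cases hsI : s ∈ Ioo 1 T
      · have hyA : y ∈ annCylClosed 1 2 L := ⟨hr1'.le, hr2.le, hzL.le⟩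
        have hlo := hge s hsI y hyA
        have hhi := hFM s hsτ y
        have h1 : |F s y - M| ≤ ε := by rw [_root_.abs_le]; constructor <;> linarith
        simp only [hbound, indicator_of_mem hy2, mul_one]
        have : |F s y - M| * (psiCut L y * |deriv (zetaCut T) s|) ≤ ε * |deriv (zetaCut T) s| :=
          mul_le_mul h1 hψz (by positivity) hε
        nlinarith [mul_nonneg hz0 (mul_nonneg hM (hind1 y))]
      · rw [deriv_zetaCut_eq_zero_of_not_mem_Ioo hsI, abs_zero, mul_zero, mul_zero]
        exact hb0
  have h := norm_integral_le_of_norm_le hbint (Eventually.of_forall hle)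
  rw [Real.norm_eq_abs] at h
  refine h.trans (le_of_eq ?_)
  simp only [hbound]
  rw [integral_const_mul, integral_add (hi1.const_mul _) (hi2.const_mul _), integral_const_mul,
    integral_const_mul, integral_indicator (measurableSet_solidCylinder 1 L),
    integral_indicator (measurableSet_solidCylinder 2 L), setIntegral_const, setIntegral_const,
    smul_eq_mul, smul_eq_mul, mul_one, mul_one, volume_real_solidCylinder 1 hL,
    volume_real_solidCylinder 2 hL]
  ring

/-- **Estimate of the axis term** (KNSS 2009, p. 10, the term controlled "by `−C₁ M² T L` with
`C₁ > 0`"): for `s ∈ (0, T]`,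
`∫ (2/r) F ∂ᵣφ ≤ −ζ(s) (M − ε) · 4 c₂ (L − 1)`, because `∂ᵣφ = ξ'(r) η ζ ≤ 0` is supported in
`{1 ≤ r ≤ 2, |z| ≤ L}` where `F ≥ M − ε ≥ 0`, `∫ (2/r) ξ'(r) η(z) dy = −2 c₂ ∫ η` and
`∫ η ≥ 2 (L − 1)`. -/
theorem estimate_III (hP : IsSourcedSwirl Cf Cu A τ' F V B) {L T M ε : ℝ}
    (hL : 1 ≤ L) (hTτ : T < τ') (hεM : 0 ≤ M - ε)
    (hge : ∀ s ∈ Ioo 1 T, ∀ y ∈ annCylClosed 1 2 L, M - ε ≤ F s y) {s : ℝ} (hs : s ∈ Ioc 0 T) :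
    ∫ y, 2 / cylRadius y * (F s y * fderiv ℝ (phiCut L T s) y (eR y)) ≤
      -(zetaCut T s * ((M - ε) * (4 * radialConst₂ * (L - 1)))) := by
  have hsτ : s < τ' := lt_of_le_of_lt hs.2 hTτ
  have hF1 : ContDiff ℝ 1 (F s) := (hP.smooth s hsτ).of_le (by norm_cast)
  have hJ : Integrable fun y => 2 / cylRadius y * (F s y * fderiv ℝ (phiCut L T s) y (eR y)) :=
    integrable_two_div_cylRadius_mul_mul_fderiv_eR hF1 (contDiff_phiCut L T s)
      (hasCompactSupport_phiCut L T s) (hP.axisymmetric s hsτ) (isAxisymmetricScalar_phiCut L T s)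
      (hP.axis s hsτ)
  obtain ⟨hηi, hηge⟩ := integrable_cutoff_and_le_integral hL
  obtain ⟨hKi, hKval⟩ := integral_two_div_cylRadius_mul_deriv_xiCut hηi
  have hK : Integrable fun y : (EuclideanSpace ℝ (Fin 3)) => zetaCut T s * (M - ε) *
      (2 / cylRadius y * deriv xiCut (cylRadius y) * Calculus.cutoff L (y 2)) := hKi.const_mul _
  obtain ⟨hζ0, hζ1⟩ := zetaCut_mem_Icc T s
  have hle : ∀ y, 2 / cylRadius y * (F s y * fderiv ℝ (phiCut L T s) y (eR y)) ≤
      zetaCut T s * (M - ε) * (2 / cylRadius y * deriv xiCut (cylRadius y) * Calculus.cutoff L (y 2)) := by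
    intro y
    rw [fderiv_phiCut_apply_eR]
    have hc : 0 ≤ 2 / cylRadius y := div_nonneg zero_le_two (cylRadius_nonneg y)
    have hξ := deriv_xiCut_nonpos (cylRadius y)
    have hη := Calculus.cutoff_nonneg L (y 2)
    have hPle : deriv xiCut (cylRadius y) * Calculus.cutoff L (y 2) * zetaCut T s ≤ 0 :=
      mul_nonpos_iff.2 (Or.inr ⟨mul_nonpos_iff.2 (Or.inr ⟨hξ, hη⟩), hζ0⟩)
    have key : (F s y - (M - ε)) *
        (deriv xiCut (cylRadius y) * Calculus.cutoff L (y 2) * zetaCut T s) ≤ 0 := by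
      by_cases h0 : deriv xiCut (cylRadius y) * Calculus.cutoff L (y 2) * zetaCut T s = 0
      · rw [h0, mul_zero]
      · obtain ⟨⟨hξ0, hη0⟩, hζne⟩ := mul_ne_zero_iff.1 h0 |>.imp_left mul_ne_zero_iff.1
        have hr1 : 1 ≤ cylRadius y := by
          by_contra h; exact hξ0 (deriv_xiCut_of_lt_one (lt_of_not_ge h))
        have hr2 : cylRadius y ≤ 2 := by
          by_contra h; exact hξ0 (deriv_xiCut_of_two_lt (lt_of_not_ge h))
        have hz : |y 2| ≤ L := by
          by_contra h; exact hη0 (Calculus.cutoff_eq_zero (le_of_lt (lt_of_not_ge h)))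
        have hsI : s ∈ Ioo 1 T := by
          by_contra h; exact hζne (zetaCut_of_not_mem_Ioo h)
        have hFge := hge s hsI y ⟨hr1, hr2, hz⟩
        exact mul_nonpos_iff.2 (Or.inl ⟨sub_nonneg.2 hFge, hPle⟩)
    have key2 : 2 / cylRadius y * ((F s y - (M - ε)) *
        (deriv xiCut (cylRadius y) * Calculus.cutoff L (y 2) * zetaCut T s)) ≤ 0 :=
      mul_nonpos_iff.2 (Or.inl ⟨hc, key⟩)
    nlinarith [key2]
  have hmono := integral_mono hJ hK hle
  refine hmono.trans ?_
  rw [integral_const_mul, hKval]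
  have hc₂ := radialConst₂_pos
  nlinarith [mul_nonneg (mul_nonneg hζ0 hεM) (mul_nonneg hc₂.le (sub_nonneg.2 hηge))]

/-- **Pointwise bound near the axis** (`0 < r < 1`): there `φ = η(z) ζ(s)`, so
`|(F − M)(Dφ[V] + Δφ)| ≤ ζ (C_f + M) (2 C_S · C_u/r + 4 C_S (C_S + 1)) 1_{S_L}(z)` (KNSS 2009,
p. 10: "the integration in x₃ is only over the segments `L − 1 ≤ |x₃| ≤ L`" and `|u| ≤ C/r`,
`∫ dx'/r < ∞`). -/
theorem near_bound (hP : IsSourcedSwirl Cf Cu A τ' F V B) {L T M s : ℝ}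
    (hsτ : s < τ') (hFM : ∀ y, F s y ≤ M) {y : (EuclideanSpace ℝ (Fin 3))} (hr0 : cylRadius y ≠ 0)
    (hr1 : cylRadius y < 1) :
    |(F s y - M) * (fderiv ℝ (phiCut L T s) y (V s y) + (Δ (phiCut L T s)) y)| ≤
      zetaCut T s * (Cf + M) *
        (2 * smoothTransitionC2Bound * Cu *
            ((Iic (1 : ℝ)).indicator (fun ρ => ρ⁻¹) (cylRadius y) *
              (etaBand L).indicator (fun _ => (1 : ℝ)) (y 2)) +
          4 * smoothTransitionC2Bound * (smoothTransitionC2Bound + 1) *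
            ((Iic (1 : ℝ)).indicator (fun _ => (1 : ℝ)) (cylRadius y) *
              (etaBand L).indicator (fun _ => (1 : ℝ)) (y 2))) := by
  rw [fderiv_phiCut_of_cylRadius_lt_one hr1, laplacian_phiCut_of_cylRadius_lt_one hr1]
  obtain ⟨hζ0, -⟩ := zetaCut_mem_Icc T s
  have hM : 0 ≤ Cf + M := by
    have h2 := (_root_.abs_le.1 (hP.abs_le s hsτ y)).1
    linarith [hFM y]
  have hrI : cylRadius y ∈ Iic (1 : ℝ) := hr1.le
  by_cases hz : y 2 ∈ etaBand L
  · have hrpos : 0 < cylRadius y := lt_of_le_of_ne (cylRadius_nonneg y) (Ne.symm hr0)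
    have h1 : |F s y - M| ≤ Cf + M := abs_sub_le_of_le_of_abs_le (hFM y) (hP.abs_le s hsτ y)
    have hv : |V s y 2| ≤ Cu * (cylRadius y)⁻¹ := by
      have hd := hP.drift_le s hsτ y
      have hn : |V s y 2| ≤ ‖V s y‖ := by
        have := PiLp.norm_apply_le (V s y) 2
        rwa [Real.norm_eq_abs] at this
      rw [← div_eq_mul_inv, le_div_iff₀ hrpos]
      nlinarith [abs_nonneg (V s y 2)]
    have hη1 := abs_deriv_etaCut_le L (y 2)
    have hη2 := abs_deriv_deriv_etaCut_le L (y 2)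
    have hC := smoothTransitionC2Bound_nonneg
    have hinner : |zetaCut T s * deriv (Calculus.cutoff L) (y 2) * V s y 2 +
        zetaCut T s * deriv (deriv (Calculus.cutoff L)) (y 2)| ≤
        zetaCut T s * (2 * smoothTransitionC2Bound * (Cu * (cylRadius y)⁻¹) +
          4 * smoothTransitionC2Bound * (smoothTransitionC2Bound + 1)) := by
      have ha : |deriv (Calculus.cutoff L) (y 2)| * |V s y 2| ≤
          2 * smoothTransitionC2Bound * (Cu * (cylRadius y)⁻¹) :=
        mul_le_mul hη1 hv (abs_nonneg _) (by positivity)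
      calc _ ≤ |zetaCut T s * deriv (Calculus.cutoff L) (y 2) * V s y 2| +
            |zetaCut T s * deriv (deriv (Calculus.cutoff L)) (y 2)| := abs_add_le _ _
        _ = zetaCut T s * (|deriv (Calculus.cutoff L) (y 2)| * |V s y 2|) +
            zetaCut T s * |deriv (deriv (Calculus.cutoff L)) (y 2)| := by
            simp only [abs_mul, abs_of_nonneg hζ0]; ring
        _ ≤ _ := by
            rw [mul_add]
            exact add_le_add (mul_le_mul_of_nonneg_left ha hζ0) (mul_le_mul_of_nonneg_left hη2 hζ0)
    rw [abs_mul]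
    calc _ ≤ (Cf + M) * (zetaCut T s * (2 * smoothTransitionC2Bound * (Cu * (cylRadius y)⁻¹) +
          4 * smoothTransitionC2Bound * (smoothTransitionC2Bound + 1))) :=
          mul_le_mul h1 hinner (abs_nonneg _) hM
      _ = _ := by simp only [indicator_of_mem hrI, indicator_of_mem hz]; ring
  · obtain ⟨h1, h2⟩ := derivs_etaCut_eq_zero_of_not_mem_etaBand hz
    simp [h1, h2, indicator_of_notMem hz]

/-- **Pointwise bound away from the axis** (`r ≥ 1`): on the support of `φ(s, ·)` and for
`s ∈ (1, T)` one has `M − ε ≤ F ≤ M`, `|u| ≤ C_u`, `‖Dφ‖, |Δφ| ≤ B`, so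
`|(F − M)(Dφ[V] + Δφ)| ≤ ε B (C_u + 1)`; for `s ∉ (1, T)`, `φ(s, ·) = 0` (KNSS 2009, p. 10:
"all the other [terms] converge to zero as `ε' → 0`"). -/
theorem far_bound (hP : IsSourcedSwirl Cf Cu A τ' F V B) {L T M ε s : ℝ}
    (hsτ : s < τ') (hε : 0 ≤ ε) (hFM : ∀ y, F s y ≤ M)
    (hge : s ∈ Ioo 1 T → ∀ y ∈ annCylClosed 1 2 L, M - ε ≤ F s y) {B : ℝ}
    (hB : ∀ y, ‖fderiv ℝ (phiCut L T s) y‖ ≤ B ∧ |(Δ (phiCut L T s)) y| ≤ B) {y : (EuclideanSpace ℝ (Fin 3))}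
    (hr1 : 1 ≤ cylRadius y) :
    |(F s y - M) * (fderiv ℝ (phiCut L T s) y (V s y) + (Δ (phiCut L T s)) y)| ≤
      ε * (B * (Cu + 1)) * (solidCylinder 2 L).indicator (fun _ => (1 : ℝ)) y := by
  have hB0 : 0 ≤ B := (norm_nonneg _).trans (hB y).1
  have hCu := Cu_nonneg hP
  by_cases hy2 : y ∈ solidCylinder 2 L
  · rw [indicator_of_mem hy2, mul_one]
    by_cases hsI : s ∈ Ioo 1 T
    · have hyA : y ∈ annCylClosed 1 2 L := ⟨hr1, hy2.1, hy2.2⟩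
      have hlo := hge hsI y hyA
      have h1 : |F s y - M| ≤ ε := by
        rw [_root_.abs_le]; constructor <;> linarith [hFM y]
      have hV : ‖V s y‖ ≤ Cu := by
        have := hP.drift_le s hsτ y
        nlinarith [norm_nonneg (V s y)]
      have h2 : |fderiv ℝ (phiCut L T s) y (V s y) + (Δ (phiCut L T s)) y| ≤ B * (Cu + 1) := by
        calc _ ≤ |fderiv ℝ (phiCut L T s) y (V s y)| + |(Δ (phiCut L T s)) y| := abs_add_le _ _
          _ ≤ B * Cu + B := by
              refine add_le_add ?_ (hB y).2
              rw [← Real.norm_eq_abs]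
              exact ((fderiv ℝ (phiCut L T s) y).le_opNorm _).trans
                (mul_le_mul (hB y).1 hV (norm_nonneg _) hB0)
          _ = B * (Cu + 1) := by ring
      rw [abs_mul]
      exact mul_le_mul h1 h2 (abs_nonneg _) hε
    · have hζ := zetaCut_of_not_mem_Ioo hsI
      have hD : fderiv ℝ (phiCut L T s) y (V s y) = 0 := by
        rw [fderiv_phiCut_eq, hζ, zero_smul]; rfl
      rw [hD, laplacian_phiCut_eq, hζ, zero_mul, add_zero, mul_zero, abs_zero]
      positivity
  · obtain ⟨-, hD, hΔ, -⟩ := phiCut_derivs_eq_zero_of_not_mem (T := T) (s := s) hy2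
    rw [hD, hΔ, indicator_of_notMem hy2]
    simp

/-- **Estimate of the transport term** (KNSS 2009, p. 10): for `s ∈ (0, T]`,
`|∫ (F − M)(Dφ[V] + Δφ)| ≤ ζ(s) (C_f + M) · 4 C_S c₂ (C_u + C_S + 1) + ε B (C_u + 1) · 2 L |B₂(0,2)|`:
the near-axis part is integrable thanks to `|u| ≤ C/r` and lives on the band `S_L` of
measure `≤ 2`; the far part is `O(ε)`. -/
theorem estimate_II (hP : IsSourcedSwirl Cf Cu A τ' F V B) {L T M ε : ℝ}
    (hL : 1 ≤ L) (hTτ : T < τ') (hε : 0 ≤ ε) (hFM : ∀ s < τ', ∀ y, F s y ≤ M)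
    (hge : ∀ s ∈ Ioo 1 T, ∀ y ∈ annCylClosed 1 2 L, M - ε ≤ F s y) {B : ℝ}
    (hB : ∀ s y, ‖fderiv ℝ (phiCut L T s) y‖ ≤ B ∧ |(Δ (phiCut L T s)) y| ≤ B) {s : ℝ}
    (hs : s ∈ Ioc 0 T) :
    |∫ y, (F s y - M) * (fderiv ℝ (phiCut L T s) y (V s y) + (Δ (phiCut L T s)) y)| ≤
      zetaCut T s * ((Cf + M) * (4 * smoothTransitionC2Bound * radialConst₂ *
          (Cu + (smoothTransitionC2Bound + 1)))) +
        ε * (B * (Cu + 1) * (2 * L * volume.real (closedBall (0 : EuclideanSpace ℝ (Fin 2)) 2))) := by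
  have hsτ : s < τ' := lt_of_le_of_lt hs.2 hTτ
  have hL0 : 0 ≤ L := zero_le_one.trans hL
  have hCu := Cu_nonneg hP
  have hC := smoothTransitionC2Bound_nonneg
  have hB0 : 0 ≤ B := (norm_nonneg _).trans (hB s 0).1
  obtain ⟨hζ0, -⟩ := zetaCut_mem_Icc T s
  have hM : 0 ≤ Cf + M := by
    have h2 := (_root_.abs_le.1 (hP.abs_le s hsτ 0)).1
    linarith [hFM s hsτ 0]
  have hS := measurableSet_etaBand L
  have hSfin := volume_etaBand_lt_top L
  have hSle := volume_real_etaBand_le L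
  obtain ⟨hiA, hA⟩ := integral_inv_cylRadius_indicator zero_le_one hS hSfin
  obtain ⟨hiB, hBv⟩ := integral_cylinder_indicator zero_le_one hS hSfin
  have hiC : Integrable ((solidCylinder 2 L).indicator fun _ : (EuclideanSpace ℝ (Fin 3)) => (1 : ℝ)) :=
    (integrableOn_const (C := (1 : ℝ)) (volume_solidCylinder_lt_top 2 L).ne).integrable_indicator
      (measurableSet_solidCylinder 2 L)
  set near : (EuclideanSpace ℝ (Fin 3)) → ℝ := fun y => zetaCut T s * (Cf + M) *
    (2 * smoothTransitionC2Bound * Cu *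
        ((Iic (1 : ℝ)).indicator (fun ρ => ρ⁻¹) (cylRadius y) *
          (etaBand L).indicator (fun _ => (1 : ℝ)) (y 2)) +
      4 * smoothTransitionC2Bound * (smoothTransitionC2Bound + 1) *
        ((Iic (1 : ℝ)).indicator (fun _ => (1 : ℝ)) (cylRadius y) *
          (etaBand L).indicator (fun _ => (1 : ℝ)) (y 2))) with hnear
  set far : (EuclideanSpace ℝ (Fin 3)) → ℝ := fun y => ε * (B * (Cu + 1)) *
    (solidCylinder 2 L).indicator (fun _ => (1 : ℝ)) y with hfar
  have hnear_int : Integrable near := ((hiA.const_mul _).add (hiB.const_mul _)).const_mul _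
  have hfar_int : Integrable far := hiC.const_mul _
  have hnear0 : ∀ y, 0 ≤ near y := by
    intro y
    have hi1 : 0 ≤ (Iic (1 : ℝ)).indicator (fun ρ => ρ⁻¹) (cylRadius y) :=
      indicator_apply_nonneg fun _ => inv_nonneg.2 (cylRadius_nonneg y)
    have hi2 : 0 ≤ (Iic (1 : ℝ)).indicator (fun _ => (1 : ℝ)) (cylRadius y) :=
      indicator_nonneg (fun _ _ => zero_le_one) _
    have hi3 : 0 ≤ (etaBand L).indicator (fun _ => (1 : ℝ)) (y 2) :=
      indicator_nonneg (fun _ _ => zero_le_one) _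
    simp only [hnear]
    positivity
  have hfar0 : ∀ y, 0 ≤ far y := by
    intro y
    have hi : 0 ≤ (solidCylinder 2 L).indicator (fun _ => (1 : ℝ)) y :=
      indicator_nonneg (fun _ _ => zero_le_one) _
    simp only [hfar]
    positivity
  have hle : ∀ᵐ y ∂(volume : Measure (EuclideanSpace ℝ (Fin 3))),
      ‖(F s y - M) * (fderiv ℝ (phiCut L T s) y (V s y) + (Δ (phiCut L T s)) y)‖ ≤
        near y + far y := by
    filter_upwards [ae_cylRadius_ne_zero] with y hy0
    rw [Real.norm_eq_abs]
    by_cases hr1 : cylRadius y < 1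
    · exact (near_bound hP hsτ (hFM s hsτ) hy0 hr1).trans (le_add_of_nonneg_right (hfar0 y))
    · exact (far_bound hP hsτ hε (hFM s hsτ) (hge s) (hB s) (le_of_not_gt hr1)).trans
        (le_add_of_nonneg_left (hnear0 y))
  have h := norm_integral_le_of_norm_le (hnear_int.add hfar_int) hle
  rw [Real.norm_eq_abs] at h
  refine h.trans ?_
  rw [integral_add' hnear_int hfar_int]
  simp only [hnear, hfar]
  rw [integral_const_mul, integral_add (hiA.const_mul _) (hiB.const_mul _), integral_const_mul,
    integral_const_mul, hA, hBv, integral_const_mul,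
    integral_indicator (measurableSet_solidCylinder 2 L), setIntegral_const, smul_eq_mul, mul_one,
    volume_real_solidCylinder 2 hL0]
  have hc₂ := radialConst₂_pos
  have key : 0 ≤ 2 * smoothTransitionC2Bound * radialConst₂ * (Cu + (smoothTransitionC2Bound + 1)) *
      (2 - volume.real (etaBand L)) := by
    have : 0 ≤ Cu + (smoothTransitionC2Bound + 1) := by positivity
    exact mul_nonneg (by positivity) (sub_nonneg.2 hSle)
  have key2 : zetaCut T s * (Cf + M) *
      (2 * smoothTransitionC2Bound * Cu * (volume.real (etaBand L) * (radialConst₂ * 1)) +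
        4 * smoothTransitionC2Bound * (smoothTransitionC2Bound + 1) *
          (volume.real (etaBand L) * (radialConst₂ * (1 ^ 2 / 2)))) ≤
      zetaCut T s * ((Cf + M) * (4 * smoothTransitionC2Bound * radialConst₂ *
          (Cu + (smoothTransitionC2Bound + 1)))) := by
    have hζM : 0 ≤ zetaCut T s * (Cf + M) := mul_nonneg hζ0 hM
    have := mul_nonneg hζM key
    nlinarith [this]
  linarith [key2]


end IsSourcedSwirl

end Summit.NavierStokesRegularity.NavierStokesRegularity.Theorems.HalfSpaceWindowDoorCirculationCarryingRigiditySourcedSwirlEstimates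

end
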